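import Summits.BirchSwinnertonDyer.BirchSwinnertonDyer.Theorems.ManinLocalTwoThreeCubeRootDescent
import Summits.BirchSwinnertonDyer.Rank1Residual.ManinAdditive.ModularFunctionFieldEta
import HarnessLib

/-!
# LAW₃ ⟸ P79: the cube-root descent with its three automorphic leaves CLOSED
(cell `bsd-f2-manin`, planner `-an` g36, MEMO-an §79.9, FILE F; proposed tree path
`Summits/BirchSwinnertonDyer/BirchSwinnertonDyer/Theorems/ManinLocalTwoThreeCubeRootDescentClosed.lean`,
`--supports stmt-BirchSwinnertonDyer-22968`)

Imports FILE B (`ManinLocalTwoThreeCubeRootDescent`: `LAW₃ ⟸ M0 ∧ M1 ∧ M2 ∧ P79`) and an's file L as landed by the typer summit-side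
(`Rank1Residual/ManinAdditive/ModularFunctionFieldLevel.lean` p715111 + `…/ModularFunctionFieldEta.lean` p715140: M0, M1, M2 PROVED, namespace
`Summit.BirchSwinnertonDyer.Rank1Residual.ManinAdditive.ModularFunctionFieldEta`).  Consequences, all sorry-free and BY NAME:

* `modularFunctionFieldMono : ModularFunctionFieldMono` (M0), `etaQuotientMemFunctionField : EtaQuotientMemFunctionField`
  (M1; the cell's `etaLaurent` and the Literature one have syntactically identical bodies, so `exact` closes it by `δ`-reduction),
  `monomialNotModularFunction : MonomialNotModularFunction` (M2);
* **N1 `cubeRepFirstDescent : CubeRepFirstDescent` PROVED** (every cuspidal Kummer cube representative at a level `9 ∣ N` has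
  `n₂ − n₁ = S₁(r)/24` and `72 ∣ S₁(r)`);
* `noNewmanCubeRootRepAtThreeN_of_geometric : KummerCubeSeriesNotCubeAtThreeN → NoNewmanCubeRootRepAtThreeN` (N2 ⟸ P79);
* **`cuspidalKummerCubeExponentLaw_of_geometric : KummerCubeSeriesNotCubeAtThreeN → CuspidalKummerCubeExponentLaw`**
  (LAW₃ ⟸ P79, tree `CuspidalKummerCubeLaws.lean` :72 BY NAME), `…NonBlind_of_geometric` (LAW₃♮ = C3 v18
  `stub_cubeExponentLawNonBlind` ⟸ P79) and `noBlindThreeTorsionOptimal_of_geometric : CuspidalKummerCubeRepresentativeAtNine →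
  KummerCubeSeriesNotCubeAtThreeN → NoBlindThreeTorsionOptimal` (NB₃ ⟸ E-an-57 ∧ P79).

So the OPEN content of LAW₃ / LAW₃♮ is exactly the single geometric statement P79 (`KummerCubeSeriesNotCubeAtThreeN`,
FILE A): the Kummer cube series of a rational `3`-torsion point on an `X₀(N)`-optimal curve, `9 ∣ N`, is not a cube in
`K_{3N}`.  Checked as the concatenation FILE A ++ FILE B ++ Literature file ++ FILE F (`CubeDescentFullSim2-an-g36.lean`,
rc 0, 0 sorry, 2026-08-29).  PARTITION unchanged · beyond-print theorem: no · BSD is not proved by this.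
-/

noncomputable section

set_option linter.dupNamespace false

namespace Summit.BirchSwinnertonDyer.BirchSwinnertonDyer.Theorems.ManinLocalTwoThree.CubeRootDescent

open Summit.BirchSwinnertonDyer.Rank1Residual.ManinAdditive.CuspidalKummer
open Summit.BirchSwinnertonDyer.Rank1Residual.ManinAdditive.CuspidalKummerThree

/-- M0 holds: `M ∣ M' ⟹ K_M ≤ K_{M'}`. -/
theorem modularFunctionFieldMono : ModularFunctionFieldMono :=
  Summit.BirchSwinnertonDyer.Rank1Residual.ManinAdditive.ModularFunctionFieldEta.modularFunctionFieldMono_shape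

/-- M2 holds: `q^m ∈ K_M ⟹ m = 0`. -/
theorem monomialNotModularFunction : MonomialNotModularFunction :=
  Summit.BirchSwinnertonDyer.Rank1Residual.ManinAdditive.ModularFunctionFieldEta.monomialNotModularFunction_shape

/-- M1 holds: Newman `η`-quotients of weight `0` have `q`-series in `K_M` (the cell's `etaLaurent` unfolds to the
Literature one). -/
theorem etaQuotientMemFunctionField : EtaQuotientMemFunctionField :=
  fun M _ s hs ↦ Summit.BirchSwinnertonDyer.Rank1Residual.ManinAdditive.ModularFunctionFieldEta.etaLaurent_mem_modularFunctionField M s hs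

/-- **N1 PROVED**: the first descent `n₂ − n₁ = S₁(r)/24 ∧ 72 ∣ S₁(r)` for every cuspidal Kummer cube representative. -/
theorem cubeRepFirstDescent : CubeRepFirstDescent :=
  cubeRepFirstDescent_of etaQuotientMemFunctionField monomialNotModularFunction

/-- N2 ⟸ P79. -/
theorem noNewmanCubeRootRepAtThreeN_of_geometric (hP : KummerCubeSeriesNotCubeAtThreeN) :
    NoNewmanCubeRootRepAtThreeN :=
  noNewmanCubeRootRepAtThreeN_of modularFunctionFieldMono etaQuotientMemFunctionField monomialNotModularFunction hP

/-- **LAW₃ ⟸ P79 (BY NAME)**: `KummerCubeSeriesNotCubeAtThreeN → CuspidalKummerCubeExponentLaw`. -/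
theorem cuspidalKummerCubeExponentLaw_of_geometric (hP : KummerCubeSeriesNotCubeAtThreeN) :
    CuspidalKummerCubeExponentLaw :=
  cuspidalKummerCubeExponentLaw_of_functionField modularFunctionFieldMono etaQuotientMemFunctionField
    monomialNotModularFunction hP

/-- LAW₃♮ (C3 v18 `stub_cubeExponentLawNonBlind`) ⟸ P79, BY NAME. -/
theorem cuspidalKummerCubeExponentLawNonBlind_of_geometric (hP : KummerCubeSeriesNotCubeAtThreeN) :
    CuspidalKummerCubeExponentLawNonBlind :=
  cuspidalKummerCubeExponentLawNonBlind_of_functionField modularFunctionFieldMono etaQuotientMemFunctionField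
    monomialNotModularFunction hP

/-- NB₃ `NoBlindThreeTorsionOptimal` ⟸ E-an-57 ∧ P79, BY NAME. -/
theorem noBlindThreeTorsionOptimal_of_geometric (h57 : CuspidalKummerCubeRepresentativeAtNine)
    (hP : KummerCubeSeriesNotCubeAtThreeN) : NoBlindThreeTorsionOptimal :=
  noBlindThreeTorsionOptimal_of_functionField modularFunctionFieldMono etaQuotientMemFunctionField
    monomialNotModularFunction hP h57

end Summit.BirchSwinnertonDyer.BirchSwinnertonDyer.Theorems.ManinLocalTwoThree.CubeRootDescent
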